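import Literature.AlgebraicGeometry.Motives.VarietiesGeometricallyIntegralProofs
import Mathlib.RingTheory.Smooth.Flat
import Mathlib.RingTheory.TensorProduct.Quotient
import Mathlib.RingTheory.DiscreteValuationRing.TFAE
import Mathlib.RingTheory.KrullDimension.Zero
import Mathlib.RingTheory.Ideal.MinimalPrime.Localization
import HarnessLib

/-!
# Generic points of the special fibre of a smooth scheme over a discrete valuation ring

Topic: `Literature/AlgebraicGeometry/Smoothening` (Bosch–Lütkebohmert–Raynaud, *Néron Models*,
§2.2–2.3 and §3.6: for a smooth `R`-scheme `Z` over a discrete valuation ring `R` with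
uniformizer `ϖ`, the local ring `𝒪_{Z,η}` at a generic point `η` of the special fibre `Z_k` is a
discrete valuation ring in which `ϖ` is again a uniformizer — an extension of `R` "of
ramification index `1`"; these are the test rings entering the Néron mapping property through
Weil's extension theorem, M. Artin, *Néron Models*, Prop. (1.3), Cor. (1.6)). Ring form, for a
smooth `R`-algebra `A` which is a domain with `ϖ ≠ 0` in `A`, and a minimal prime `P` of `ϖA`:

* `isReduced_quotient_span_of_smooth` — the special fibre `A/ϖA` is reduced (it is
  `k ⊗_R A`, smooth over the residue field `k`, hence reduced,
  `Motives.isReduced_of_smooth_of_field`);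
* `maximalIdeal_localization_eq_span` — the maximal ideal of `A_P` is generated by `ϖ`
  (`(A/ϖA)_{P̄}` is a reduced zero-dimensional local ring, a field);
* `isDiscreteValuationRing_localization`, `irreducible_algebraMap_localization` — `A_P` is a
  discrete valuation ring and `ϖ` is a uniformizer of it.

[folklore]; no named facts (D-0026).

## References

* S. Bosch, W. Lütkebohmert, M. Raynaud, *Néron Models*, Springer 1990, §2.3, §3.6.
  [BLRNeronModels1990] (Not held; section numbers only.)
* M. Artin, *Néron Models*, in Cornell–Silverman (eds.), *Arithmetic Geometry*, Springer 1986,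
  Prop. (1.3), Cor. (1.6) (pp. 215–216). [Artin1986NeronModels]
-/

noncomputable section

open scoped TensorProduct
open IsLocalRing
open Literature.AlgebraicGeometry.Motives

namespace Literature.AlgebraicGeometry.Smoothening

universe u

variable {R : Type u} [CommRing R] [IsDomain R] [IsDiscreteValuationRing R] {ϖ : R} (hϖ : Irreducible ϖ)
  (A : Type u) [CommRing A] [Algebra R A]

include hϖ in
/-- **The special fibre of a smooth scheme over a discrete valuation ring is reduced**, ring form:
`A/ϖA ≅ k ⊗_R A` is smooth over the residue field `k = R/(ϖ)`, hence reduced. [folklore] -/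
theorem isReduced_quotient_span_of_smooth [Algebra.Smooth R A] :
    IsReduced (A ⧸ Ideal.span {algebraMap R A ϖ}) := by
  haveI : (Ideal.span {ϖ}).IsMaximal := hϖ.maximalIdeal_eq ▸ maximalIdeal.isMaximal R
  letI := Ideal.Quotient.field (Ideal.span {ϖ})
  haveI : IsReduced ((R ⧸ Ideal.span {ϖ}) ⊗[R] A) :=
    isReduced_of_smooth_of_field (R ⧸ Ideal.span {ϖ}) _
  have hmap : (Ideal.span {ϖ}).map (algebraMap R A) = Ideal.span {algebraMap R A ϖ} := by
    rw [Ideal.map_span, Set.image_singleton]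
  rw [← hmap]
  let e := (Algebra.TensorProduct.quotIdealMapEquivTensorQuot A (Ideal.span {ϖ})).toRingEquiv.trans
    (Algebra.TensorProduct.comm R A (R ⧸ Ideal.span {ϖ})).toRingEquiv
  exact isReduced_of_injective e e.injective

variable {A} (P : Ideal A) [P.IsPrime] (hP : P ∈ (Ideal.span {algebraMap R A ϖ}).minimalPrimes)

omit [P.IsPrime] in
include hϖ hP in
/-- For a minimal prime `P` of `ϖA`, every element of `P` becomes a multiple of `ϖ` after
inverting some `s ∉ P`: the localisation of the reduced ring `A/ϖA` at the minimal prime `P/ϖA`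
is a field. [folklore] -/
theorem exists_mul_mem_span_of_mem [Algebra.Smooth R A] {x : A} (hx : x ∈ P) :
    ∃ s ∉ P, s * x ∈ Ideal.span {algebraMap R A ϖ} := by
  haveI := isReduced_quotient_span_of_smooth hϖ A
  set J : Ideal A := Ideal.span {algebraMap R A ϖ} with hJ
  -- `P̄ = P/ϖA` is a minimal prime of `A/ϖA`
  have hPbar : P.map (Ideal.Quotient.mk J) ∈ minimalPrimes (A ⧸ J) := by
    have h := Ideal.minimalPrimes_map_of_surjective (Ideal.Quotient.mk_surjective (I := J)) J
    rw [Ideal.mk_ker, sup_idem, Ideal.map_quotient_self] at h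
    change _ ∈ Ideal.minimalPrimes ⊥
    rw [h]
    exact ⟨P, hP, rfl⟩
  haveI := hPbar.1.1
  -- its localisation is a field
  let L := Localization.AtPrime (P.map (Ideal.Quotient.mk J))
  haveI : Ring.KrullDimLE 0 L := Ring.KrullDimLE.of_isLocalization _ hPbar L
  have hF : IsField L := Ring.KrullDimLE.isField_of_isReduced
  -- so `x̄ ↦ 0` in it
  have hx0 : algebraMap (A ⧸ J) L (Ideal.Quotient.mk J x) = 0 := by
    have hmem : algebraMap (A ⧸ J) L (Ideal.Quotient.mk J x) ∈ maximalIdeal L := by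
      rw [← Localization.AtPrime.map_eq_maximalIdeal]
      exact Ideal.mem_map_of_mem _ (Ideal.mem_map_of_mem _ hx)
    rwa [(isField_iff_maximalIdeal_eq.mp hF), Ideal.mem_bot] at hmem
  obtain ⟨⟨m, hm⟩, hmx⟩ := (IsLocalization.map_eq_zero_iff (P.map (Ideal.Quotient.mk J)).primeCompl L _).mp hx0
  obtain ⟨s, rfl⟩ := Ideal.Quotient.mk_surjective m
  refine ⟨s, fun hs => hm (Ideal.mem_map_of_mem _ hs), ?_⟩
  rw [← Ideal.Quotient.eq_zero_iff_mem, map_mul]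
  exact hmx

include hϖ hP in
/-- **The maximal ideal of `A_P` is generated by `ϖ`** for a minimal prime `P` of `ϖA`, `A` smooth
over the discrete valuation ring `R`. [folklore] -/
theorem maximalIdeal_localization_eq_span [Algebra.Smooth R A] :
    maximalIdeal (Localization.AtPrime P) =
      Ideal.span {algebraMap R (Localization.AtPrime P) ϖ} := by
  apply le_antisymm
  · rw [← Localization.AtPrime.map_eq_maximalIdeal, Ideal.map_le_iff_le_comap]
    intro x hx
    obtain ⟨s, hs, hsx⟩ := exists_mul_mem_span_of_mem hϖ P hP hx
    obtain ⟨y, hy⟩ := Ideal.mem_span_singleton'.mp hsx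
    have hu : IsUnit (algebraMap A (Localization.AtPrime P) s) :=
      IsLocalization.map_units (Localization.AtPrime P) (⟨s, hs⟩ : P.primeCompl)
    rw [Ideal.mem_comap, Ideal.mem_span_singleton']
    refine ⟨hu.unit⁻¹ * algebraMap A (Localization.AtPrime P) y, ?_⟩
    rw [IsScalarTower.algebraMap_apply R A (Localization.AtPrime P), mul_assoc, ← map_mul, hy,
      map_mul, ← mul_assoc, IsUnit.val_inv_mul, one_mul]
  · rw [Ideal.span_singleton_le_iff_mem, IsScalarTower.algebraMap_apply R A (Localization.AtPrime P),
      ← Localization.AtPrime.map_eq_maximalIdeal]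
    exact Ideal.mem_map_of_mem _ (hP.1.2 (Ideal.mem_span_singleton_self _))

include hϖ hP in
/-- **`A_P` is a discrete valuation ring** for a minimal prime `P` of `ϖA`, `A` a domain smooth over
the discrete valuation ring `R` with `ϖ ≠ 0` in `A` (Noetherian local domain whose maximal ideal
is principal and non-zero). [folklore] -/
theorem isDiscreteValuationRing_localization [Algebra.Smooth R A] [IsDomain A]
    (hϖA : algebraMap R A ϖ ≠ 0) : IsDiscreteValuationRing (Localization.AtPrime P) := by
  haveI : Algebra.FiniteType R A := inferInstance
  haveI : IsNoetherianRing A := Algebra.FiniteType.isNoetherianRing R A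
  haveI : IsDomain (Localization.AtPrime P) :=
    IsLocalization.isDomain_localization P.primeCompl_le_nonZeroDivisors
  have hmax := maximalIdeal_localization_eq_span hϖ P hP
  have hne : algebraMap R (Localization.AtPrime P) ϖ ≠ 0 := by
    rw [IsScalarTower.algebraMap_apply R A (Localization.AtPrime P)]
    exact fun h0 => hϖA (IsLocalization.injective (Localization.AtPrime P)
      P.primeCompl_le_nonZeroDivisors (by rw [h0, map_zero]))
  have hnf : ¬ IsField (Localization.AtPrime P) := by
    rw [isField_iff_maximalIdeal_eq, hmax, Ideal.span_singleton_eq_bot]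
    exact hne
  have hprin : (maximalIdeal (Localization.AtPrime P)).IsPrincipal := ⟨⟨_, hmax⟩⟩
  exact ((IsDiscreteValuationRing.TFAE (Localization.AtPrime P) hnf).out 0 4).mpr hprin

include hϖ hP in
/-- **`ϖ` is a uniformizer of `A_P`**: the local ring of a smooth `R`-scheme at a generic point of
its special fibre is a test ring for the smoothening process ("ramification index `1`").
[folklore] -/
theorem irreducible_algebraMap_localization [Algebra.Smooth R A] [IsDomain A]
    (hϖA : algebraMap R A ϖ ≠ 0) : Irreducible (algebraMap R (Localization.AtPrime P) ϖ) := by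
  haveI : IsDomain (Localization.AtPrime P) :=
    IsLocalization.isDomain_localization P.primeCompl_le_nonZeroDivisors
  have hne : algebraMap R (Localization.AtPrime P) ϖ ≠ 0 := by
    rw [IsScalarTower.algebraMap_apply R A (Localization.AtPrime P)]
    exact fun h0 => hϖA (IsLocalization.injective (Localization.AtPrime P)
      P.primeCompl_le_nonZeroDivisors (by rw [h0, map_zero]))
  exact IsDiscreteValuationRing.irreducible_of_span_eq_maximalIdeal _ hne
    (maximalIdeal_localization_eq_span hϖ P hP)

end Literature.AlgebraicGeometry.Smoothening

end
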